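import Literature.Probability.RandomPlanarGeometry.SquaredWalkPolygons
import Literature.Probability.RandomPlanarGeometry.BDGS2012Proofs
import Literature.Probability.Percolation.ScaledLatticeWalks
import HarnessLib

/-!
# Surgery on self-avoiding paths and polygons: opening a polygon at an edge, merging two
# polygons along two connecting paths, disjoint sub-arcs of a path, straight walks of `ℤ²`

Topic `Literature/Probability/RandomPlanarGeometry` (next to `SquaredWalkPolygons.lean`, whose
`isPath_append_cons` and `eq_of_isPath_of_edges_toFinset_eq` are in the same spirit). The file
collects the elementary walk surgery used by the Peierls-type estimates of H. Duminil-Copin,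
G. Kozma, A. Yadin, *Supercritical self-avoiding walks are space-filling*, Ann. IHP Probab. Stat. 50
(2014), §3 ("by changing the edges `[cd]` and `[ab]` of `γ` and `γ'` into the edges `[ac]` and
`[bd]`, one obtains a polygon", the symmetric difference of a walk and a polygon, …), phrased
for Mathlib's `SimpleGraph.Walk` and the tree's `IsPolygon G E` (the edge set of a cycle,
`SupercriticalSAWPolygons.lean`):

* (appending two self-avoiding paths meeting only at the junction is
  `Zd.isPath_append_of_inter` of `BDGS2012Proofs.lean`, used throughout;)
* `IsPolygon.exists_isPath_erase` — **opening a polygon at an edge**: if `s(a,b)` is an edge of a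
  polygon `E`, there is a self-avoiding path from `a` to `b` with edge set `E ∖ {s(a,b)}`, whose
  vertices are the vertices of `E`, of length `#E - 1`;
* `isPolygon_insert_of_isPath` — closing a path of length `≥ 2` with the edge between its ends;
* `IsPolygon.merge` — **merging two vertex-disjoint polygons** `E₁ ∋ s(a,b)`, `E₂ ∋ s(c,d)` along
  two vertex-disjoint paths `a ⇝ c`, `b ⇝ d` otherwise avoiding both: the result
  `(E₁ ∖ {ab}) ∪ (E₂ ∖ {cd}) ∪ R₁ ∪ R₂` is a polygon with `#E₁ + #E₂ - 2 + |R₁| + |R₂|` edges;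
* `exists_disjoint_subpaths` — two vertices `x ≠ y` on a self-avoiding path are joined to the two
  ends of the path by vertex-disjoint sub-paths (`x` to the start and `y` to the end when `x`
  comes first);
* `lineWalk`, `hWalk`, `vWalk` — the straight walk of `ℤ²` from a site to the site of the same
  axis line with prescribed coordinate (horizontal / vertical cases), with their supports
  (`mem_support_hWalk_iff`: the sites of the row between the two ends), lengths and
  self-avoidance.

Relation to the tree. `IsPolygon.exists_isPath_erase` is the `SimpleGraph.Walk` form of
`IsPolygon.exists_open` of `SAWPolygonOpening.lean` (same namespace; there the opened polygon is
a self-avoiding vertex LIST from `a` to `b` with consecutive pairs `E ∖ {s(a,b)}` — it is the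
`support` of the path produced here, so `exists_open` is derivable from this lemma; librarian
merge candidate). The straight walks are built on `Literature.Probability.Percolation.runWalk`
(`ScaledLatticeWalks.lean`: the run `v, v + d, …, v + n d` of a unit step `d`, with
`mem_support_runWalk_iff`), to which this file adds `length_runWalk` and `runWalk_isPath`; other
copies of straight lattice walks in the tree (`QuantumLattice.lineWalk`, the private `axisWalk` of
`Barriers/CriticalPhenomena/TransverseCrossingsNeedNotMeet.lean`, `SlabGluing.exists_walk_up/right`)
are merge candidates for the same API. Translating edge sets / polygons of `ℤ²` is
`SupercriticalSAW.shiftEdges`, `isPolygon_shiftEdges` of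
`Barriers/CriticalPhenomena/SupercriticalSAWSpaceFillingBoxesRungs.lean`, `…BoxesShift.lean` (not
repeated here). Mathlib: `Walk.mem_support_iff_exists_mem_edges_of_not_nil`,
`Walk.rotate`, `IsCycle.rotate`, `IsPath.isCycle_append`, `IsPath.eq_penultimate_of_mem_edges`,
`Walk.takeUntil`/`dropUntil`, `notMem_support_takeUntil_support_takeUntil_subset`.

Everything here is [folklore]; no statement of the source is vendored in this file.
-/

noncomputable section

open SimpleGraph Literature.Probability.LatticeModels Literature.Probability.Percolation

namespace Literature.Probability.RandomPlanarGeometry.SAW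

section Generic

variable {V : Type*} {G : SimpleGraph V}

/-! ### Opening a polygon at an edge -/

variable [DecidableEq V]

/-- A cycle based at `a` whose second vertex is `b` is the edge `ab` followed by (the reverse
of) a self-avoiding path from `a` to `b` carrying the other edges. [folklore] -/
theorem exists_isPath_of_isCycle_of_snd_eq {a b : V} {d : G.Walk a a} (hd : d.IsCycle)
    (hb : d.snd = b) :
    ∃ P : G.Walk a b, P.IsPath ∧ P.edges.toFinset = d.edges.toFinset.erase s(a, b) ∧
      s(a, b) ∉ P.edges ∧ P.length + 1 = d.length ∧ P.support.toFinset = d.support.toFinset := by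
  cases d with
  | nil => exact absurd hd Walk.not_isCycle_nil
  | cons h t =>
    rename_i y
    rw [Walk.snd_cons] at hb
    subst hb
    rw [Walk.cons_isCycle_iff] at hd
    refine ⟨t.reverse, hd.1.reverse, ?_, ?_, ?_, ?_⟩
    · rw [Walk.edges_reverse, List.toFinset_reverse, Walk.edges_cons, List.toFinset_cons,
        Finset.erase_insert]
      rw [List.mem_toFinset]
      exact hd.2
    · rw [Walk.edges_reverse, List.mem_reverse]
      exact hd.2
    · rw [Walk.length_reverse, Walk.length_cons]
    · rw [Walk.support_reverse, List.toFinset_reverse, Walk.support_cons, List.toFinset_cons,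
        Finset.insert_eq_of_mem]
      rw [List.mem_toFinset]
      exact t.end_mem_support

omit [DecidableEq V] in
/-- In a cycle based at `a`, an edge `ab` of the cycle is its first or its last edge: `b` is the
second vertex of the cycle or of the reversed cycle. [folklore] -/
theorem snd_eq_or_snd_reverse_eq_of_mem_edges {a b : V} {d : G.Walk a a} (hd : d.IsCycle)
    (hab : s(a, b) ∈ d.edges) : d.snd = b ∨ d.reverse.snd = b := by
  cases d with
  | nil => exact absurd hd Walk.not_isCycle_nil
  | cons h t =>
    rename_i y
    rw [Walk.edges_cons, List.mem_cons] at hab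
    rcases hab with hab | hab
    · left
      rw [Walk.snd_cons]
      exact (Sym2.congr_right.1 hab).symm
    · right
      rw [Walk.cons_isCycle_iff] at hd
      have htn : ¬ t.Nil := fun htn => by
        cases htn
        simp at hab
      rw [Walk.snd_reverse, Walk.penultimate_cons_of_not_nil _ _ htn]
      exact (hd.1.eq_penultimate_of_mem_edges hab).symm

/-- **Opening a polygon at an edge.** If `s(a,b)` is an edge of a polygon `E` (the edge set of
a cycle), there is a self-avoiding path from `a` to `b` with edge set `E ∖ {s(a,b)}`, not using
`s(a,b)`, of length `#E - 1`, whose vertices are exactly the vertices of the edges of `E`.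
[folklore] -/
theorem IsPolygon.exists_isPath_erase {E : Finset (Sym2 V)} (hE : IsPolygon G E) {a b : V}
    (hab : s(a, b) ∈ E) :
    ∃ P : G.Walk a b, P.IsPath ∧ P.edges.toFinset = E.erase s(a, b) ∧ s(a, b) ∉ P.edges ∧
      P.length + 1 = E.card ∧ ∀ x, x ∈ P.support ↔ ∃ e ∈ E, x ∈ e := by
  obtain ⟨w, c, hc, rfl⟩ := hE
  have habc : s(a, b) ∈ c.edges := List.mem_toFinset.1 hab
  have ha : a ∈ c.support := c.fst_mem_support_of_mem_edges habc
  -- rotate the cycle to start at `a`, and reverse it if needed so that `b` comes second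
  have key : ∀ d : G.Walk a a, d.IsCycle → d.edges.toFinset = c.edges.toFinset → d.snd = b →
      ∃ P : G.Walk a b, P.IsPath ∧ P.edges.toFinset = c.edges.toFinset.erase s(a, b) ∧
        s(a, b) ∉ P.edges ∧ P.length + 1 = c.edges.toFinset.card ∧
        ∀ x, x ∈ P.support ↔ ∃ e ∈ c.edges.toFinset, x ∈ e := by
    intro d hd hde hdb
    obtain ⟨P, hP, hPe, hPab, hPl, hPs⟩ := exists_isPath_of_isCycle_of_snd_eq hd hdb
    refine ⟨P, hP, hde ▸ hPe, hPab, ?_, fun x => ?_⟩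
    · rw [← hde, List.toFinset_card_of_nodup hd.edges_nodup, Walk.length_edges, hPl]
    · rw [← hde, ← List.mem_toFinset, hPs, List.mem_toFinset,
        Walk.mem_support_iff_exists_mem_edges_of_not_nil hd.not_nil]
      simp only [List.mem_toFinset]
  set d := c.rotate a ha with hd_def
  have hd : d.IsCycle := hc.rotate ha
  have hde : d.edges.toFinset = c.edges.toFinset :=
    List.toFinset_eq_of_perm _ _ (c.rotate_edges a ha).perm
  have habd : s(a, b) ∈ d.edges := by rw [← List.mem_toFinset, hde]; exact hab
  rcases snd_eq_or_snd_reverse_eq_of_mem_edges hd habd with h | h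
  · exact key d hd hde h
  · refine key d.reverse hd.reverse ?_ h
    rw [Walk.edges_reverse, List.toFinset_reverse, hde]

/-- Closing a self-avoiding path from `a` to `b` not using the edge `ab` with that edge gives a
polygon with one more edge (the path then has length at least `2`). [folklore] -/
theorem isPolygon_insert_of_isPath {a b : V} {P : G.Walk a b} (hP : P.IsPath) (h : G.Adj b a)
    (hab : s(a, b) ∉ P.edges) :
    IsPolygon G (insert s(a, b) P.edges.toFinset) ∧
      (insert s(a, b) P.edges.toFinset).card = P.length + 1 := by
  have hc : (Walk.cons h P).IsCycle := by
    rw [Walk.cons_isCycle_iff]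
    exact ⟨hP, fun h' => hab (by rwa [Sym2.eq_swap])⟩
  refine ⟨⟨b, Walk.cons h P, hc, ?_⟩, ?_⟩
  · rw [Walk.edges_cons, List.toFinset_cons, Sym2.eq_swap]
  · rw [Finset.card_insert_of_notMem (by rwa [List.mem_toFinset]),
      List.toFinset_card_of_nodup hP.edges_nodup, Walk.length_edges]

/-! ### Merging two polygons along two connecting paths -/

/-- **Merging two polygons.** Let `E₁ ∋ s(a,b)` and `E₂ ∋ s(c,d)` be vertex-disjoint polygons,
`R₁ : a ⇝ c` and `R₂ : b ⇝ d` vertex-disjoint self-avoiding paths meeting the vertices of `E₁`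
only in `a` (resp. `b`) and those of `E₂` only in `c` (resp. `d`). Then replacing the edges
`ab`, `cd` by the two paths ("changing the edges `[cd]` and `[ab]` of `γ` and `γ'` into the
edges `[ac]` and `[bd]`, one obtains a polygon") gives a polygon, with
`#E₁ + #E₂ - 2 + |R₁| + |R₂|` edges. [folklore] -/
theorem IsPolygon.merge {E₁ E₂ : Finset (Sym2 V)} (h₁ : IsPolygon G E₁) (h₂ : IsPolygon G E₂)
    {a b c d : V} (hab : s(a, b) ∈ E₁) (hcd : s(c, d) ∈ E₂) {R₁ : G.Walk a c} {R₂ : G.Walk b d}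
    (hR₁ : R₁.IsPath) (hR₂ : R₂.IsPath)
    (hE : ∀ x, (∃ e ∈ E₁, x ∈ e) → (∃ e ∈ E₂, x ∈ e) → False)
    (hR₁E₁ : ∀ x ∈ R₁.support, (∃ e ∈ E₁, x ∈ e) → x = a)
    (hR₁E₂ : ∀ x ∈ R₁.support, (∃ e ∈ E₂, x ∈ e) → x = c)
    (hR₂E₁ : ∀ x ∈ R₂.support, (∃ e ∈ E₁, x ∈ e) → x = b)
    (hR₂E₂ : ∀ x ∈ R₂.support, (∃ e ∈ E₂, x ∈ e) → x = d)
    (hR : ∀ x ∈ R₁.support, x ∉ R₂.support) :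
    IsPolygon G (E₁.erase s(a, b) ∪ E₂.erase s(c, d) ∪ (R₁.edges.toFinset ∪ R₂.edges.toFinset)) ∧
      (E₁.erase s(a, b) ∪ E₂.erase s(c, d) ∪ (R₁.edges.toFinset ∪ R₂.edges.toFinset)).card + 2 =
        E₁.card + E₂.card + R₁.length + R₂.length := by
  -- open `E₁` at `ba` and `E₂` at `cd`
  have hba : s(b, a) ∈ E₁ := by rw [Sym2.eq_swap]; exact hab
  obtain ⟨P₁, hP₁, hP₁e, hP₁ba, hP₁l, hP₁s⟩ := h₁.exists_isPath_erase hba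
  obtain ⟨P₂, hP₂, hP₂e, hP₂cd, hP₂l, hP₂s⟩ := h₂.exists_isPath_erase hcd
  -- the long path `b ⇝ a ⇝ c ⇝ d`
  have hT₁ : (P₁.append R₁).IsPath :=
    Zd.isPath_append_of_inter hP₁ hR₁ fun x hx hx' => hR₁E₁ x hx' ((hP₁s x).1 hx)
  have hT : ((P₁.append R₁).append P₂).IsPath := by
    refine Zd.isPath_append_of_inter hT₁ hP₂ fun x hx hx' => ?_
    rw [Walk.mem_support_append_iff] at hx
    rcases hx with hx | hx
    · exact (hE x ((hP₁s x).1 hx) ((hP₂s x).1 hx')).elim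
    · exact hR₁E₂ x hx ((hP₂s x).1 hx')
  -- closing it with `R₂` gives a cycle
  have hcyc : (((P₁.append R₁).append P₂).append R₂.reverse).IsCycle := by
    refine hT.isCycle_append hR₂.reverse ?_ (Or.inl ?_)
    · intro x hx hx'
      have hx1 : x ∈ ((P₁.append R₁).append P₂).support := List.mem_of_mem_tail hx
      have hxR₂ : x ∈ R₂.support := by
        have := List.mem_of_mem_tail hx'
        rwa [Walk.support_reverse, List.mem_reverse] at this
      -- `x ≠ b` (tail of a path starting at `b`) and `x ≠ d` (tail of a path starting at `d`)
      have hxb : x ≠ b := by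
        rintro rfl
        have hnd := (Walk.isPath_def _).1 hT
        rw [← Walk.cons_tail_support] at hnd
        exact (List.nodup_cons.1 hnd).1 hx
      have hxd : x ≠ d := by
        rintro rfl
        have hnd := (Walk.isPath_def _).1 hR₂.reverse
        rw [← Walk.cons_tail_support] at hnd
        exact (List.nodup_cons.1 hnd).1 hx'
      rw [Walk.mem_support_append_iff, Walk.mem_support_append_iff] at hx1
      rcases hx1 with (hx1 | hx1) | hx1
      · exact hxb (hR₂E₁ x hxR₂ ((hP₁s x).1 hx1))
      · exact hR x hx1 hxR₂
      · exact hxd (hR₂E₂ x hxR₂ ((hP₂s x).1 hx1))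
    · rw [Walk.length_append, Walk.length_append]
      have : 2 ≤ P₁.length := by
        -- a polygon has at least three edges
        obtain ⟨w, cyc, hcyc, hE₁⟩ := h₁
        have h3 := hcyc.three_le_length
        rw [← Walk.length_edges, ← List.toFinset_card_of_nodup hcyc.edges_nodup, hE₁] at h3
        omega
      omega
  -- its edge set and number of edges
  have hedges : (((P₁.append R₁).append P₂).append R₂.reverse).edges.toFinset =
      E₁.erase s(a, b) ∪ E₂.erase s(c, d) ∪ (R₁.edges.toFinset ∪ R₂.edges.toFinset) := by
    rw [Walk.edges_append, Walk.edges_append, Walk.edges_append, Walk.edges_reverse,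
      List.toFinset_append, List.toFinset_append, List.toFinset_append, List.toFinset_reverse,
      hP₁e, hP₂e, Sym2.eq_swap]
    ext e
    simp only [Finset.mem_union]
    tauto
  refine ⟨⟨b, _, hcyc, hedges⟩, ?_⟩
  rw [← hedges, List.toFinset_card_of_nodup hcyc.edges_nodup, Walk.length_edges,
    Walk.length_append, Walk.length_append, Walk.length_append, Walk.length_reverse]
  omega

/-! ### Two disjoint sub-arcs of a self-avoiding path -/

/-- The final segment of a walk from a vertex `y` of it other than its start has its support in
the tail of the support of the walk. [folklore] -/
theorem support_dropUntil_subset_tail {x b : V} (r : G.Walk x b) {y : V} (hy : y ∈ r.support)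
    (hyx : y ≠ x) : ∀ z ∈ (r.dropUntil y hy).support, z ∈ r.support.tail := by
  cases r with
  | nil =>
    rw [Walk.support_nil, List.mem_singleton] at hy
    exact absurd hy hyx
  | cons h r' =>
    intro z hz
    rw [Walk.support_cons, List.tail_cons]
    have hy' : y ∈ r'.support := by
      rw [Walk.support_cons, List.mem_cons] at hy
      exact hy.resolve_left hyx
    have : (Walk.cons h r').dropUntil y hy = r'.dropUntil y hy' := by
      simp [Walk.dropUntil, Ne.symm hyx]
    rw [this] at hz
    exact Walk.support_dropUntil_subset_support _ _ hz

/-- **Two disjoint sub-arcs.** On a self-avoiding path `p : a ⇝ b`, if `y` does not lie on the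
initial segment up to `x`, then the reversed initial segment `x ⇝ a` and the final segment
`y ⇝ b` are vertex-disjoint self-avoiding sub-paths. [folklore] -/
theorem exists_disjoint_subpaths {a b : V} {p : G.Walk a b} (hp : p.IsPath) {x y : V}
    (hx : x ∈ p.support) (hy : y ∈ p.support) (hyx : y ∉ (p.takeUntil x hx).support) :
    ∃ (q₁ : G.Walk x a) (q₂ : G.Walk y b), q₁.IsPath ∧ q₂.IsPath ∧
      (∀ z ∈ q₁.support, z ∈ p.support) ∧ (∀ z ∈ q₂.support, z ∈ p.support) ∧
      ∀ z ∈ q₁.support, z ∉ q₂.support := by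
  set r := p.dropUntil x hx with hr
  have hspec : (p.takeUntil x hx).append r = p := p.take_spec hx
  have hyr : y ∈ r.support := by
    have : y ∈ ((p.takeUntil x hx).append r).support := by rw [hspec]; exact hy
    rw [Walk.mem_support_append_iff] at this
    exact this.resolve_left hyx
  have hyx' : y ≠ x := by
    rintro rfl
    exact hyx (Walk.end_mem_support _)
  refine ⟨(p.takeUntil x hx).reverse, r.dropUntil y hyr, (hp.takeUntil hx).reverse,
    (hp.dropUntil hx).dropUntil hyr, fun z hz => ?_, fun z hz => ?_, fun z hz hz' => ?_⟩
  · rw [Walk.support_reverse, List.mem_reverse] at hz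
    exact p.support_takeUntil_subset_support hx hz
  · exact p.support_dropUntil_subset_support hx (r.support_dropUntil_subset_support hyr hz)
  · rw [Walk.support_reverse, List.mem_reverse] at hz
    have hz'' := support_dropUntil_subset_tail r hyr hyx' z hz'
    have hrn : ¬ r.Nil := fun hrn => by
      rw [Walk.nil_iff_support_eq.1 hrn, List.mem_singleton] at hyr
      exact hyx' hyr
    have hpath : ((p.takeUntil x hx).append r).IsPath := by rw [hspec]; exact hp
    have hdis := hpath.disjoint_support_of_append hrn
    rw [Walk.support_tail_of_not_nil _ hrn] at hdis
    exact hdis hz hz''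

/-- The dichotomy feeding `exists_disjoint_subpaths`: of two distinct vertices of a walk, one
does not lie on the initial segment up to the other. [folklore] -/
theorem notMem_takeUntil_or {a b : V} {p : G.Walk a b} {x y : V} (hx : x ∈ p.support)
    (hy : y ∈ p.support) (hxy : x ≠ y) :
    y ∉ (p.takeUntil x hx).support ∨ x ∉ (p.takeUntil y hy).support := by
  by_cases h : y ∈ (p.takeUntil x hx).support
  · exact Or.inr (Walk.notMem_support_takeUntil_support_takeUntil_subset hxy.symm hx h)
  · exact Or.inl h

end Generic

/-! ### Straight walks of `ℤ²` -/

section Lattice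

/-- A straight run of `n` unit steps has length `n`. [folklore] -/
@[simp] theorem length_runWalk (d : Site 2) (hd : (zdGraph 2).Adj 0 d) (v : Site 2) (n : ℕ) :
    (runWalk d hd v n).length = n := by
  induction n generalizing v with
  | zero => rfl
  | succ n ih =>
    show (Walk.cons _ (runWalk d hd (v + d) n)).length = n + 1
    rw [Walk.length_cons, ih]

/-- Straight runs are self-avoiding (a unit step is non-zero and `ℤ²` is torsion-free).
[folklore] -/
theorem runWalk_isPath (d : Site 2) (hd : (zdGraph 2).Adj 0 d) (v : Site 2) (n : ℕ) :
    (runWalk d hd v n).IsPath := by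
  have hd0 : d ≠ 0 := fun h => hd.ne h.symm
  induction n generalizing v with
  | zero => exact Walk.IsPath.nil
  | succ n ih =>
    show (Walk.cons _ (runWalk d hd (v + d) n)).IsPath
    rw [Walk.cons_isPath_iff]
    refine ⟨ih _, fun hv => ?_⟩
    rw [mem_support_runWalk_iff] at hv
    obtain ⟨j, -, hj⟩ := hv
    have h2 : ((j : ℤ) + 1) • d = 0 := by
      calc ((j : ℤ) + 1) • d = (v + d + (j : ℤ) • d) - v := by rw [add_smul, one_smul]; abel
        _ = 0 := by rw [← hj, sub_self]
    rcases smul_eq_zero.1 h2 with h | h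
    · omega
    · exact hd0 h

/-- The unit coordinate vectors are neighbours of the origin. [folklore] -/
theorem zdGraph_adj_zero_single (i : Fin 2) : (zdGraph 2).Adj (0 : Site 2) (Pi.single i 1) :=
  (zdGraph_adj_iff _ _).2 ⟨i, Or.inl (by simp)⟩

/-- The negative unit coordinate vectors are neighbours of the origin. [folklore] -/
theorem zdGraph_adj_zero_neg_single (i : Fin 2) :
    (zdGraph 2).Adj (0 : Site 2) (-Pi.single i 1) :=
  (zdGraph_adj_iff _ _).2 ⟨i, Or.inr (by simp)⟩

/-- **The straight walk along the `i`-th axis** from the site `p` to the site of the same axis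
line with `i`-th coordinate `a` (`Function.update p i a`). [folklore] -/
def lineWalk (p : Site 2) (i : Fin 2) (a : ℤ) : (zdGraph 2).Walk p (Function.update p i a) :=
  if h : p i ≤ a then
    (runWalk (Pi.single i 1) (zdGraph_adj_zero_single i) p (a - p i).toNat).copy rfl (by
      rw [iterate_add_right_eq]
      funext j
      rcases eq_or_ne j i with rfl | hj
      · simp [Int.toNat_of_nonneg (sub_nonneg.2 h)]
      · simp [hj])
  else
    (runWalk (-Pi.single i 1) (zdGraph_adj_zero_neg_single i) p (p i - a).toNat).copy rfl (by
      rw [iterate_add_right_eq]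
      funext j
      rcases eq_or_ne j i with rfl | hj
      · simp [Int.toNat_of_nonneg (by omega : 0 ≤ p j - a)]
      · simp [hj])

/-- The straight walk has length `|a - pᵢ|`. [folklore] -/
@[simp] theorem length_lineWalk (p : Site 2) (i : Fin 2) (a : ℤ) :
    (lineWalk p i a).length = (a - p i).natAbs := by
  unfold lineWalk
  split_ifs with h
  · simp only [Walk.length_copy, length_runWalk]; omega
  · simp only [Walk.length_copy, length_runWalk]; omega

/-- Straight walks along an axis are self-avoiding. [folklore] -/
theorem lineWalk_isPath (p : Site 2) (i : Fin 2) (a : ℤ) : (lineWalk p i a).IsPath := by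
  unfold lineWalk
  split_ifs <;> simpa only [Walk.isPath_copy] using runWalk_isPath _ _ _ _

/-- The vertices of the straight walk from `p` along the `i`-th axis to coordinate `a`: the sites
agreeing with `p` off the `i`-th coordinate whose `i`-th coordinate lies between `pᵢ` and `a`.
[folklore] -/
theorem mem_support_lineWalk_iff {p : Site 2} {i : Fin 2} {a : ℤ} {x : Site 2} :
    x ∈ (lineWalk p i a).support ↔
      (∀ j, j ≠ i → x j = p j) ∧ min (p i) a ≤ x i ∧ x i ≤ max (p i) a := by
  unfold lineWalk
  split_ifs with h
  · rw [Walk.support_copy, mem_support_runWalk_iff, min_eq_left h, max_eq_right h]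
    constructor
    · rintro ⟨t, ht, rfl⟩
      have ht' : (t : ℤ) ≤ a - p i := by
        have := Int.toNat_of_nonneg (sub_nonneg.2 h); omega
      refine ⟨fun j hj => by simp [hj], ?_, ?_⟩
      · simp
      · simp; omega
    · rintro ⟨hj, h1, h2⟩
      refine ⟨(x i - p i).toNat, ?_, ?_⟩
      · have := Int.toNat_of_nonneg (sub_nonneg.2 h)
        have := Int.toNat_of_nonneg (by omega : 0 ≤ x i - p i)
        omega
      · funext j
        rcases eq_or_ne j i with rfl | hji
        · simp [Int.toNat_of_nonneg (by omega : 0 ≤ x j - p j)]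
        · simp [hji, hj j hji]
  · push Not at h
    rw [Walk.support_copy, mem_support_runWalk_iff, min_eq_right h.le, max_eq_left h.le]
    constructor
    · rintro ⟨t, ht, rfl⟩
      have ht' : (t : ℤ) ≤ p i - a := by
        have := Int.toNat_of_nonneg (by omega : 0 ≤ p i - a); omega
      refine ⟨fun j hj => by simp [hj], ?_, ?_⟩
      · simp; omega
      · simp
    · rintro ⟨hj, h1, h2⟩
      refine ⟨(p i - x i).toNat, ?_, ?_⟩
      · have := Int.toNat_of_nonneg (by omega : 0 ≤ p i - a)
        have := Int.toNat_of_nonneg (by omega : 0 ≤ p i - x i)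
        omega
      · funext j
        rcases eq_or_ne j i with rfl | hji
        · simp [Int.toNat_of_nonneg (by omega : 0 ≤ p j - x j)]
        · simp [hji, hj j hji]

/-- **Horizontal straight walk** from `p` to the site of its row in column `a`. [folklore] -/
abbrev hWalk (p : Site 2) (a : ℤ) : (zdGraph 2).Walk p (Function.update p 0 a) := lineWalk p 0 a

/-- **Vertical straight walk** from `p` to the site of its column in row `b`. [folklore] -/
abbrev vWalk (p : Site 2) (b : ℤ) : (zdGraph 2).Walk p (Function.update p 1 b) := lineWalk p 1 b

/-- The vertices of the horizontal walk: same row, abscissa between `p₀` and `a`. [folklore] -/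
theorem mem_support_hWalk_iff {p : Site 2} {a : ℤ} {x : Site 2} :
    x ∈ (hWalk p a).support ↔ x 1 = p 1 ∧ min (p 0) a ≤ x 0 ∧ x 0 ≤ max (p 0) a := by
  rw [hWalk, mem_support_lineWalk_iff]
  constructor
  · rintro ⟨h, h1, h2⟩; exact ⟨h 1 (by decide), h1, h2⟩
  · rintro ⟨h, h1, h2⟩
    refine ⟨fun j hj => ?_, h1, h2⟩
    fin_cases j
    · exact absurd rfl hj
    · exact h

/-- The vertices of the vertical walk: same column, ordinate between `p₁` and `b`. [folklore] -/
theorem mem_support_vWalk_iff {p : Site 2} {b : ℤ} {x : Site 2} :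
    x ∈ (vWalk p b).support ↔ x 0 = p 0 ∧ min (p 1) b ≤ x 1 ∧ x 1 ≤ max (p 1) b := by
  rw [vWalk, mem_support_lineWalk_iff]
  constructor
  · rintro ⟨h, h1, h2⟩; exact ⟨h 0 (by decide), h1, h2⟩
  · rintro ⟨h, h1, h2⟩
    refine ⟨fun j hj => ?_, h1, h2⟩
    fin_cases j
    · exact h
    · exact absurd rfl hj

end Lattice


end Literature.Probability.RandomPlanarGeometry.SAW
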